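import Summits.BirchSwinnertonDyer.BirchSwinnertonDyer.Theses.PAdicOrderV2
import Summits.BirchSwinnertonDyer.BirchSwinnertonDyer.Theorems.PAdicOrderV2PAdicOrderThesisR2StubUBRank0
import Literature.NumberTheory.EllipticCurves.OrdinaryPrimesProofs

/-!
# Strategist census s2 — crux #3 `PAdicOrderPadicBSDrankR2` (stmt-BirchSwinnertonDyer-0490)
# typed part (companion of `STRATEGY-CENSUS.md`, unit cstrat-stmt-BirchSwinnertonDyer-0490-s2)

Crux (fixed): `∀ W [IsElliptic] [IsGloballyMinimal] p [Fact p.Prime], IsOrdinaryAt W p →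
∀ {N} [NeZero N] (f : CuspForm (Gamma0 N) 2), IsNewformOf W f →
(padicLFunction f (unitRoot W p)).order = W.mordellWeilRank`.

This file adds to the s1 census (`StrategistCensus0490.lean`, b79f6753282f: cuts (P)/(M)/(A),
S⁺/S⁻) two further TYPED cuts, each with its glue PROVED, and the observation that decides them:

* **Cut (R), rank stratification** — `RankZeroSlice ∧ PosRankSlice ↔ crux` (`crux_iff_slices`),
  and the identification `rankZeroSlice_iff_rankZeroConverse`: modulo modularity (inlined exactly
  as in the route's support `CruxesToThesis`), the rank-zero slice of this `p`-ADIC crux is the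
  `p`-FREE rank-zero converse of Kolyvagin–Kato, `rank E(ℚ) = 0 → ord_{s=1} L(E,s) = 0`
  (`RankZeroConverse`; open in print: it contains finiteness of `Ш(E)[p^∞]` for rank-0 curves at
  one Skinner–Urban prime). So even the EASIEST slice of the crux is a standing open problem shared
  with route SelmerRank's Ш-leg, and the positive-rank slice carries the whole semisimplicity leg
  (item 0509): the stratification gives no leverage (census § Decomposition (R)).
* **Cut (H), halves** — `LowerHalf` (`rank ≤ ord`, Kato's theorem 18.4 + Kummer, in print at every
  good ordinary prime, literature debt at `p = 2`) `∧ UpperHalf` (`ord ≤ rank`, the open direction)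
  `↔ crux` (`crux_iff_halves`). `UpperHalf` is the crux's entire open content (restatement-suspect
  as a child), recorded only to pin the negation analysis: a counterexample to the crux at odd `p`
  is a counterexample to `UpperHalf`, i.e. an EXACT extra vanishing (census § Negation).

* **§ Necessity (the tenure finding of this census)** — the crux is SUFFICIENT but NOT NECESSARY
  for the route's thesis node X = `PAdicOrderThesisR2` (an `∃ p` statement). The necessary-and-
  sufficient rank clause, given crux #2 `PAdicOrderComparisonR2`, is `RankClauseAtOnePrime`
  (`∃` good ordinary `p`, `∃` newform `f`, `ord_T L_p(f,α_p,T) = rank`):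
  `thesis_iff_rankClause_of_comparison : PAdicOrderComparisonR2 → (PAdicOrderThesisR2 ↔
  RankClauseAtOnePrime)`, with `rankClauseAtOnePrime_of_crux` (crux ⇒ clause, modularity inlined)
  and `cruxesToThesis_via_rankClause`. Consequence for the route (census § Verdict): item 0490 as
  typed carries the `p = 2` window and the Eisenstein-at-every-`p` main-conjecture residues that X
  never uses; its thesis-faithful replacement is `RankClauseAtOnePrime` (a `--restate`, tenure).

No `sorry`; standard axioms only (lean check rc 0, 0 warnings).
-/

-- D-0017: single-problem summit, so `Summit.BirchSwinnertonDyer.BirchSwinnertonDyer.…` repeats a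
-- namespace BY DESIGN.
set_option linter.dupNamespace false

noncomputable section

namespace Summit.BirchSwinnertonDyer.BirchSwinnertonDyer.Cruxes.PAdicOrderPadicBSDrankR2.StrategistS2

open scoped MatrixGroups ModularForm
open CongruenceSubgroup Literature.NumberTheory.EllipticCurves
  Literature.NumberTheory.EllipticCurves.ModularForms
open Summit.BirchSwinnertonDyer.BirchSwinnertonDyer.Theses.PAdicOrderV2

/-! ## Cut (R): rank stratification -/

/-- Rank-zero slice of the crux: at every good ordinary point of a RANK-ZERO curve,
`ord_{T=0} L_p(E,T) = 0`. [cite: MazurTateTeitelbaum1986Invent, §II.10] -/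
def RankZeroSlice : Prop :=
  ∀ (W : WeierstrassCurve ℚ) [W.IsElliptic] [W.IsGloballyMinimal] (p : ℕ) [Fact p.Prime],
    IsOrdinaryAt W p → ∀ {N : ℕ} [NeZero N] (f : CuspForm (Gamma0 N) 2), IsNewformOf W f →
    W.mordellWeilRank = 0 → (padicLFunction f (unitRoot W p : ℚ_[p])).order = 0

/-- Positive-rank slice of the crux. [cite: MazurTateTeitelbaum1986Invent, §II.10] -/
def PosRankSlice : Prop :=
  ∀ (W : WeierstrassCurve ℚ) [W.IsElliptic] [W.IsGloballyMinimal] (p : ℕ) [Fact p.Prime],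
    IsOrdinaryAt W p → ∀ {N : ℕ} [NeZero N] (f : CuspForm (Gamma0 N) 2), IsNewformOf W f →
    1 ≤ W.mordellWeilRank →
    (padicLFunction f (unitRoot W p : ℚ_[p])).order = W.mordellWeilRank

/-- The `p`-FREE rank-zero converse of Kolyvagin–Kato for globally minimal models:
`rank_ℤ E(ℚ) = 0 → ord_{s=1} L(E,s) = 0`. Open in print (it contains `Ш(E)[p^∞]` finite for
rank-0 curves; known only under that finiteness at a Skinner–Urban prime). [cite: SkinnerUrban2014, Thm 2 (b)] -/
def RankZeroConverse : Prop :=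
  ∀ (W : WeierstrassCurve ℚ) [W.IsElliptic] [W.IsGloballyMinimal],
    W.mordellWeilRank = 0 → W.analyticRank = 0

/-- Modularity, inlined verbatim as the antecedent of the route's support item `CruxesToThesis`
(stmt-14877): every elliptic `W/ℚ` has a newform of level `N_W`.
[cite: DiamondShurman2005, Thm 8.8.3] -/
def ModularityInlined : Prop :=
  ∀ (W : WeierstrassCurve ℚ) [W.IsElliptic] [NeZero (W.conductorNorm ℤ)],
    ∃ f : CuspForm (Gamma0 (W.conductorNorm ℤ)) 2, IsNewformOf W f

/-- **Glue of cut (R)** (exact): the crux is the conjunction of its two rank slices. [folklore] -/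
theorem crux_iff_slices : PAdicOrderPadicBSDrankR2 ↔ RankZeroSlice ∧ PosRankSlice := by
  constructor
  · intro h
    refine ⟨fun W _ _ p _ hord N _ f hf h0 ↦ ?_, fun W _ _ p _ hord N _ f hf _ ↦ h W p hord f hf⟩
    rw [h W p hord f hf, h0, Nat.cast_zero]
  · rintro ⟨h0, hpos⟩ W _ _ p _ hord N _ f hf
    rcases Nat.eq_zero_or_pos W.mordellWeilRank with hr | hr
    · rw [h0 W p hord f hf hr, hr, Nat.cast_zero]
    · exact hpos W p hord f hf hr

/-- **The rank-zero converse implies the rank-zero slice, with NO modularity and at EVERY good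
ordinary prime (`p = 2, 3` included)**: by the proved level-zero interpolation window
`ord_T L_p = 0 ↔ r_an = 0` (`KatoSandwich.order_padicLFunction_eq_zero_iff_analyticRank_eq_zero`,
MTT86 §I.14 (14.3): `L_p(E,0) = (1-α⁻¹)² L(E,1)/Ω⁺`, `α ≠ 1`).
[cite: MazurTateTeitelbaum1986Invent, §I.14 (14.3) and §II.10] -/
theorem rankZeroSlice_of_rankZeroConverse (h : RankZeroConverse) : RankZeroSlice := by
  intro W _ _ p _ hord N _ f hf h0
  exact (Cruxes.PAdicOrderThesisR2.KatoSandwich.order_padicLFunction_eq_zero_iff_analyticRank_eq_zero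
    W p hord hf).mpr (h W h0)

/-- **Conversely, the rank-zero slice gives the `p`-free rank-zero converse** — modularity enters
only to supply the newform (a good ordinary `p ≥ 5` exists for every curve: PROVED,
`WeierstrassCurve.exists_good_ordinary_prime_holds`). [cite: Serre1981, §8] -/
theorem rankZeroConverse_of_rankZeroSlice (hmod : ModularityInlined) (h : RankZeroSlice) :
    RankZeroConverse := by
  intro W _ _ h0
  haveI : NeZero (W.conductorNorm ℤ) := ⟨(WeierstrassCurve.conductorNorm_pos_holds (W := W)).ne'⟩
  obtain ⟨f, hf⟩ := hmod W
  obtain ⟨p, hp, -, hgood, hordp⟩ := WeierstrassCurve.exists_good_ordinary_prime_holds W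
  have hord : IsOrdinaryAt W p := ⟨hgood, hordp⟩
  exact (Cruxes.PAdicOrderThesisR2.KatoSandwich.order_padicLFunction_eq_zero_iff_analyticRank_eq_zero
    W p hord hf).mp (h W p hord f hf h0)

/-- **The rank-zero slice of the `p`-adic crux IS the `p`-free rank-zero converse** (modulo
modularity, carried inlined as in the route). [folklore] -/
theorem rankZeroSlice_iff_rankZeroConverse (hmod : ModularityInlined) :
    RankZeroSlice ↔ RankZeroConverse :=
  ⟨rankZeroConverse_of_rankZeroSlice hmod, rankZeroSlice_of_rankZeroConverse⟩

/-- Hence the crux itself delivers the rank-zero converse (re-derivation, for this cut, of the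
disprover's `bsdRank_rankZero_cases_of_crux`, Negative/ConsequencesOfCrux p102285). [folklore] -/
theorem rankZeroConverse_of_crux (hmod : ModularityInlined) (h : PAdicOrderPadicBSDrankR2) :
    RankZeroConverse :=
  rankZeroConverse_of_rankZeroSlice hmod (crux_iff_slices.mp h).1

/-! ## Cut (H): the two inequalities -/

/-- Lower half `rank ≤ ord_T L_p` at every good ordinary prime: Kato's Thm 18.4 + Kummer
(`rank ≤ corank Sel_{p^∞} ≤ ord`), in print parity-free (Astérisque 295, Thm 17.4 (2) p. 273,
Thm 18.4 p. 281); in the tree it is the support item `PAdicOrderKatoSideR2` (stmt-0491) at odd `p`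
plus the named fact `kato_selmerCorank_le_order_padicLFunction_allPrimes` at `p = 2` — literature
debt, not open mathematics. [cite: Kato2004Asterisque, Thm 18.4 (p. 281)] -/
def LowerHalf : Prop :=
  ∀ (W : WeierstrassCurve ℚ) [W.IsElliptic] [W.IsGloballyMinimal] (p : ℕ) [Fact p.Prime],
    IsOrdinaryAt W p → ∀ {N : ℕ} [NeZero N] (f : CuspForm (Gamma0 N) 2), IsNewformOf W f →
    (W.mordellWeilRank : ℕ∞) ≤ (padicLFunction f (unitRoot W p : ℚ_[p])).order

/-- Upper half `ord_T L_p ≤ rank` ("no excess zero at `T = 0`"): the crux's ENTIRE open content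
(modulo Kato + control + the main conjecture at `(T)` it is Greenberg's Conj. 1.12 at `T` ∧
`Ш[p^∞]`-cotorsion, landed exactness p136413). [cite: MazurTateTeitelbaum1986Invent, §II.10] -/
def UpperHalf : Prop :=
  ∀ (W : WeierstrassCurve ℚ) [W.IsElliptic] [W.IsGloballyMinimal] (p : ℕ) [Fact p.Prime],
    IsOrdinaryAt W p → ∀ {N : ℕ} [NeZero N] (f : CuspForm (Gamma0 N) 2), IsNewformOf W f →
    (padicLFunction f (unitRoot W p : ℚ_[p])).order ≤ W.mordellWeilRank

/-- **Glue of cut (H)** (exact). [folklore] -/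
theorem crux_iff_halves : PAdicOrderPadicBSDrankR2 ↔ LowerHalf ∧ UpperHalf := by
  constructor
  · intro h
    exact ⟨fun W _ _ p _ hord N _ f hf ↦ (h W p hord f hf).ge,
      fun W _ _ p _ hord N _ f hf ↦ (h W p hord f hf).le⟩
  · rintro ⟨hlo, hup⟩ W _ _ p _ hord N _ f hf
    exact le_antisymm (hup W p hord f hf) (hlo W p hord f hf)

/-- **Where a counterexample must live** (negation bookkeeping): given the lower half (Kato), the
crux FAILS at a good ordinary point iff the `rank`-th Taylor coefficient of `L_p(E,T)` vanishes
there — an exact `p`-adic vanishing, certifiable by no finite-precision computation; whereas its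
NON-vanishing (the confirming direction) is certified by one non-zero residue mod `p^n`
(Stein–Wuthrich 2013 §3; the lead's tree criterion p140228 at `p = 2`). [cite: SteinWuthrich2013, §3 and §8] -/
theorem crux_fails_at_iff_coeff_rank_eq_zero (hlo : LowerHalf) (W : WeierstrassCurve ℚ) [W.IsElliptic]
    [W.IsGloballyMinimal] (p : ℕ) [Fact p.Prime] (hord : IsOrdinaryAt W p) {N : ℕ} [NeZero N]
    (f : CuspForm (Gamma0 N) 2) (hf : IsNewformOf W f) :
    (padicLFunction f (unitRoot W p : ℚ_[p])).order ≠ W.mordellWeilRank ↔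
      PowerSeries.coeff W.mordellWeilRank (padicLFunction f (unitRoot W p : ℚ_[p])) = 0 := by
  have hge := hlo W p hord f hf
  set L := padicLFunction f (unitRoot W p : ℚ_[p]) with hL
  -- below the rank every coefficient vanishes, by the lower half (Kato)
  have hlow : ∀ i, i < W.mordellWeilRank → PowerSeries.coeff i L = 0 := fun i hi ↦
    PowerSeries.coeff_of_lt_order i (lt_of_lt_of_le (by exact_mod_cast hi) hge)
  constructor
  · intro hne
    by_contra hc
    exact hne (PowerSeries.order_eq_nat.mpr ⟨hc, hlow⟩)
  · intro hc heq
    exact (PowerSeries.order_eq_nat.mp heq).1 hc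

/-! ## § Necessity: the rank clause the thesis X actually consumes (tenure finding, typed)

The crux (MTT BSD(p)(i) at EVERY good ordinary prime) is SUFFICIENT for the thesis node
`PAdicOrderThesisR2` (with crux #2) but NOT NECESSARY for it: X is an `∃ p` statement. The
necessary-and-sufficient rank clause, given crux #2, is the `∃ p ∃ f` form below — strictly weaker
than the crux (`rankClauseAtOnePrime_of_crux`), implied by X (`rankClauseAtOnePrime_of_thesis`),
and closing X together with crux #2 with NO modularity antecedent (`thesis_of_comparison_of_rankClause`;
the newform is part of the datum). Kernel-checked: `thesis_iff_rankClause_of_comparison`. -/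

/-- **Rank clause at ONE good ordinary prime (the thesis-faithful form of crux #3).** For every
elliptic `E/ℚ` (globally minimal `W`) there are a good ordinary prime `p` and a newform `f` of `W`
with `ord_{T=0} L_p(f, α_p, T) = rank_ℤ E(ℚ)`. Strictly weaker than MTT's BSD(p)(i) `∀ p`
(= the crux); equivalent, modulo Kato + control + the main conjecture at the chosen prime, to
"some good ordinary `p` has non-degenerate cyclotomic height AND finite `Ш(E)[p^∞]`"; contains the
`p`-free rank-zero converse (rank `0 ⇒ L(E,1) ≠ 0`). [cite: MazurTateTeitelbaum1986Invent, §II.10] -/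
def RankClauseAtOnePrime : Prop :=
  ∀ (W : WeierstrassCurve ℚ) [W.IsElliptic] [W.IsGloballyMinimal], ∃ (p : ℕ) (_ : Fact p.Prime),
    IsOrdinaryAt W p ∧ ∃ (N : ℕ) (_ : NeZero N) (f : CuspForm (Gamma0 N) 2), IsNewformOf W f ∧
      (padicLFunction f (unitRoot W p : ℚ_[p])).order = W.mordellWeilRank

/-- **Necessity**: the thesis node X implies the one-prime rank clause (projection). [folklore] -/
theorem rankClauseAtOnePrime_of_thesis (hX : PAdicOrderThesisR2) : RankClauseAtOnePrime := by
  intro W _ _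
  obtain ⟨p, hp, hord, N, hN, f, hf, -, hrk⟩ := hX W
  exact ⟨p, hp, hord, N, hN, f, hf, hrk⟩

/-- **Sufficiency with crux #2, modularity-free**: comparison `∀ p` + rank clause at one prime ⇒ X.
[folklore] -/
theorem thesis_of_comparison_of_rankClause (h2 : PAdicOrderComparisonR2)
    (h3 : RankClauseAtOnePrime) : PAdicOrderThesisR2 := by
  intro W _ _
  obtain ⟨p, hp, hord, N, hN, f, hf, hrk⟩ := h3 W
  exact ⟨p, hp, hord, N, hN, f, hf, h2 W p hord f hf, hrk⟩

/-- **Given crux #2, the thesis X is EQUIVALENT to the one-prime rank clause.** So the route's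
second crux, in its necessary-and-sufficient form, is `RankClauseAtOnePrime`, not BSD(p)(i) `∀ p`.
[folklore] -/
theorem thesis_iff_rankClause_of_comparison (h2 : PAdicOrderComparisonR2) :
    PAdicOrderThesisR2 ↔ RankClauseAtOnePrime :=
  ⟨rankClauseAtOnePrime_of_thesis, thesis_of_comparison_of_rankClause h2⟩

/-- **The crux is strictly on the strong side**: crux ⇒ one-prime rank clause (a good ordinary
`p ≥ 5` exists, PROVED; the newform from modularity, inlined as in the route). The converse
implication fails in intent (the clause says nothing at the other primes) — not formalised. [folklore] -/
theorem rankClauseAtOnePrime_of_crux (hmod : ModularityInlined) (h : PAdicOrderPadicBSDrankR2) :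
    RankClauseAtOnePrime := by
  intro W _ _
  haveI hN : NeZero (W.conductorNorm ℤ) := ⟨(WeierstrassCurve.conductorNorm_pos_holds (W := W)).ne'⟩
  obtain ⟨f, hf⟩ := hmod W
  obtain ⟨p, hp, -, hgood, hordp⟩ := WeierstrassCurve.exists_good_ordinary_prime_holds W
  have hord : IsOrdinaryAt W p := ⟨hgood, hordp⟩
  exact ⟨p, hp, hord, W.conductorNorm ℤ, hN, f, hf, h W p hord f hf⟩

/-- The route's existing glue restated through the necessary clause: modularity (inlined) →
crux #2 → crux #3 → X factors as crux #3 ⇒ `RankClauseAtOnePrime` ⇒ (with #2) X. [folklore] -/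
theorem cruxesToThesis_via_rankClause (hmod : ModularityInlined) (h2 : PAdicOrderComparisonR2)
    (h3 : PAdicOrderPadicBSDrankR2) : PAdicOrderThesisR2 :=
  thesis_of_comparison_of_rankClause h2 (rankClauseAtOnePrime_of_crux hmod h3)

end Summit.BirchSwinnertonDyer.BirchSwinnertonDyer.Cruxes.PAdicOrderPadicBSDrankR2.StrategistS2

end
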